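import Summits.PneNP.PneNP.Theorems.ConvexRankGatesCaptureTJoinSymbolic
import Summits.PneNP.PneNP.Theorems.ConvexRankGatesCaptureTJoinPairing
import Summits.PneNP.PneNP.Theorems.ConvexRankGatesCaptureGRankShadow
import Mathlib.Combinatorics.SimpleGraph.Connectivity.Finite
import Mathlib.LinearAlgebra.Matrix.Permutation
import Mathlib.Algebra.CharP.Algebra
import HarnessLib

/-!
# Crux `Capture` (stmt-PneNP-2659) — the T-JOIN door is ONE GRANK gate

**Theorem (`pairConnected_isGRankGate`).** Fix a finite vertex type `V`, an edge list `(p i, q i)`,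
`i : Fin n` (the inputs: `v i = 1` selects edge `i`) and terminals `τ : Fin k → V`. The monotone function

  `v ↦ [the terminals can be perfectly paired so that the two terminals of each pair are connected in
        the selected subgraph]`

is ONE generic-rank gate of dimension `|V|(|V|+1)k + k`: there are a field `F` and matrices
`K₀, K_i ∈ F^{d × d}` with `f v = 1 ↔ rank_{Frac F[X]} (K₀ + Σ_{v_i = 1} X_i K_i) = d`.

For pairwise distinct terminals this is existence of a `T`-JOIN inside the selected edges, i.e.
`𝟙_T ∈ span_{𝔽₂} {e_u + e_w : uw selected}` — the GRAPHIC case of the abelian-PERM / XOR-SAT door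
(Tseitin systems), until now placed only in PERM. So the generic-rank door absorbs a second piece of
`𝔽₂`-linear algebra besides matchings, by a new mechanism: a PFAFFIAN PAIRING of transfer polynomials.

Proof. `F = Frac ℚ[γ_{ij}]`; the symbolic matrix is the transfer matrix `bigN` (edge weights `X_i`,
SKEW generic source weights `c i j = ±γ`), affine in `X` (`totalDegree_bigN_le_one`), whose determinant is
`± det schurM`, `schurM j i = c i j · ((1 + A)^{|V|}) (τ j) (τ i)` (`det_bigN`). Killing the unselected
variables commutes with everything (`bigN_map`). SOUNDNESS: if no good pairing exists, some connectivity
class of the selected subgraph holds an odd number of terminals (`exists_perm_pairing_of_even_fibers`);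
`schurM` is block diagonal along the classes (`schurM_blockTriangular`, walks stay inside classes) and
alternating (`schurM_transpose`), and an odd alternating block has determinant `0`
(`det_eq_zero_of_transpose_eq_neg_of_odd`). COMPLETENESS: given a good pairing `σ`, specialise
`X_i ↦ [v_i]`, `γ_{ij} ↦ [σ i = j]` (through `ℚ[γ][X]`, where the generic weights ARE variables —
`schurM_map`, injectivity of `ℚ[γ] → F`): the pairing matrix becomes `diag(d) · P_σ` with
`d j = ±((1 + A)^{|V|})(τ j, τ (σ j)) > 0` (`pow_card_apply_pos_of_reachable`), determinant `± Π d ≠ 0`.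
No Pfaffian is ever computed. [folklore]
-/

namespace Summit.PneNP.PneNP.Theorems.Capture.TJoin

set_option linter.dupNamespace false -- `Summit.PneNP.PneNP.…`: summit = sub-problem (D-0017)

open Matrix Finset Literature.Computability.Complexity MvPolynomial
open Summit.PneNP.PneNP.Theorems.Capture.ValiantBarrier (symbolicPolyMatrix_coeffs_eq)

noncomputable section

variable {V : Type} [Fintype V] [DecidableEq V] {n k : ℕ}

/-! ### Soundness: no good pairing ⇒ the pairing matrix is singular -/

/-- **Soundness.** Over a commutative ring without `2`-torsion: if the unselected edge weights vanish, the
source weights are skew, and the terminals can NOT be perfectly paired inside the connectivity classes of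
the selected subgraph, then `det schurM = 0` (an odd class gives an odd alternating diagonal block).
[folklore] -/
theorem det_schurM_eq_zero_of_no_pairing {P : Type} [CommRing P] [NoZeroDivisors P] [CharZero P]
    (p q : Fin n → V) (τ : Fin k → V) (v : Fin n → Bool) (w : Fin n → P)
    (hw : ∀ i, v i = false → w i = 0) (c : Fin k → Fin k → P) (hc : ∀ i j, c j i = -c i j) (L : ℕ)
    (hno : ¬ ∃ σ : Equiv.Perm (Fin k), (∀ j, σ j ≠ j) ∧ (∀ j, σ (σ j) = j) ∧
      ∀ j, (SimpleGraph.fromRel fun a b : V => ∃ i, v i = true ∧ p i = a ∧ q i = b).Reachable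
        (τ j) (τ (σ j))) :
    (schurM p q τ w c L).det = 0 := by
  classical
  set G : SimpleGraph V := SimpleGraph.fromRel fun a b : V => ∃ i, v i = true ∧ p i = a ∧ q i = b with hG
  let cls : Fin k → G.ConnectedComponent := fun j => G.connectedComponentMk (τ j)
  -- some connectivity class holds an odd number of terminals
  have hodd : ∃ b, Odd ((Finset.univ.filter fun j => cls j = b).card) := by
    by_contra hall
    push Not at hall
    have heven : ∀ b, Even ((Finset.univ.filter fun j => cls j = b).card) :=
      fun b => Nat.not_odd_iff_even.1 (hall b)
    obtain ⟨σ, h1, h2, h3⟩ := exists_perm_pairing_of_even_fibers cls heven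
    exact hno ⟨σ, h1, h2, fun j => (SimpleGraph.ConnectedComponent.eq.1 (h3 j)).symm⟩
  obtain ⟨b₀, hb₀⟩ := hodd
  -- block structure along the classes, transported to a linear order
  let eK := Fintype.equivFin G.ConnectedComponent
  let lab : Fin k → Fin (Fintype.card G.ConnectedComponent) := fun j => eK (cls j)
  have hBT : (schurM p q τ w c L).BlockTriangular lab := by
    refine schurM_blockTriangular p q τ v w hw c L lab fun j i hne hreach => hne ?_
    exact congrArg eK (SimpleGraph.ConnectedComponent.sound hreach)
  rw [hBT.det]
  have hmem : eK b₀ ∈ Finset.univ.image lab := by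
    have hne : (Finset.univ.filter fun j => cls j = b₀).Nonempty := by
      rw [← Finset.card_pos]
      exact hb₀.pos
    obtain ⟨j₀, hj₀⟩ := hne
    rw [Finset.mem_filter] at hj₀
    exact Finset.mem_image.2 ⟨j₀, Finset.mem_univ _, by show eK (cls j₀) = eK b₀; rw [hj₀.2]⟩
  refine Finset.prod_eq_zero hmem ?_
  -- the odd alternating block
  refine det_eq_zero_of_transpose_eq_neg_of_odd _
    (toSquareBlock_transpose_of_transpose_eq_neg _ (schurM_transpose p q τ w c hc L) lab (eK b₀)) ?_
  rw [Fintype.card_subtype]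
  have hfil : (Finset.univ.filter fun j => lab j = eK b₀) = Finset.univ.filter fun j => cls j = b₀ := by
    ext j
    simp only [Finset.mem_filter, Finset.mem_univ, true_and, lab]
    exact eK.injective.eq_iff
  rw [hfil]
  exact hb₀

/-! ### Completeness at the rational specialisation -/

/-- **Completeness at a good pairing.** Over `ℚ`, with the indicator edge weights of the selection and
source weights `c` supported on a good pairing `σ` (`c i j = 0` unless `j = σ i`, `c i (σ i) ≠ 0`), the
pairing matrix is `diag(d) · P_σ` with `d ≠ 0`, so its determinant is non-zero. [folklore] -/
theorem det_schurM_indicator_ne_zero (p q : Fin n → V) (τ : Fin k → V) (v : Fin n → Bool)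
    (σ : Equiv.Perm (Fin k)) (h2 : ∀ j, σ (σ j) = j)
    (h3 : ∀ j, (SimpleGraph.fromRel fun a b : V => ∃ i, v i = true ∧ p i = a ∧ q i = b).Reachable
      (τ j) (τ (σ j)))
    (c : Fin k → Fin k → ℚ) (hc0 : ∀ i j, σ i ≠ j → c i j = 0) (hc1 : ∀ i, c i (σ i) ≠ 0) :
    (schurM p q τ (fun i => if v i then (1 : ℚ) else 0) c (Fintype.card V)).det ≠ 0 := by
  classical
  set W := (1 + adjW p q (fun i => if v i then (1 : ℚ) else 0)) ^ Fintype.card V with hW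
  let d : Fin k → ℚ := fun j => c (σ j) j * W (τ j) (τ (σ j))
  have hM : schurM p q τ (fun i => if v i then (1 : ℚ) else 0) c (Fintype.card V) =
      Matrix.diagonal d * σ.permMatrix ℚ := by
    ext j i
    rw [schurM_apply, Matrix.mul_apply, Finset.sum_eq_single j, Matrix.diagonal_apply_eq]
    · simp only [Equiv.Perm.permMatrix, PEquiv.toMatrix_apply, Equiv.toPEquiv_apply, Option.mem_def,
        Option.some.injEq, mul_ite, mul_one, mul_zero]
      by_cases hji : σ j = i
      · subst hji
        rw [if_pos rfl]
      · rw [if_neg hji]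
        have hij : σ i ≠ j := fun h => hji (by rw [← h, h2])
        rw [hc0 i j hij, zero_mul]
    · intro x _ hx
      rw [Matrix.diagonal_apply_ne _ (Ne.symm hx), zero_mul]
    · intro h
      exact absurd (Finset.mem_univ j) h
  rw [hM, Matrix.det_mul, Matrix.det_diagonal, Matrix.det_permutation]
  refine mul_ne_zero (Finset.prod_ne_zero_iff.2 fun j _ => mul_ne_zero ?_ ?_) ?_
  · have h := hc1 (σ j)
    rwa [h2] at h
  · exact (pow_card_apply_pos_of_reachable p q v (h3 j)).ne'
  · exact Int.cast_ne_zero.2 (Units.ne_zero _)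

/-! ### The gate -/

/-- **The T-join door is ONE GRANK gate (registered sub-goal `pairConnected_isGRankGate`).** For a fixed
multigraph (edge list `(p i, q i)`, inputs `i : Fin n`) and terminals `τ : Fin k → V`, the monotone
function `[the terminals admit a perfect pairing whose pairs are connected in the selected subgraph]`
(for distinct terminals: a `T`-join exists inside the selection; equivalently `𝟙_T` lies in the `𝔽₂`-span
of the selected edge vectors — graphic XOR-SAT / Tseitin) is a generic-rank threshold gate of dimension
`|V|(|V|+1)k + k`. [folklore] -/
theorem pairConnected_isGRankGate : ∀ (V : Type) [Fintype V] [DecidableEq V] (n k : ℕ)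
    (p q : Fin n → V) (τ : Fin k → V) (f : (Fin n → Bool) → Bool),
    (∀ v, f v = true ↔ ∃ σ : Equiv.Perm (Fin k), (∀ j, σ j ≠ j) ∧ (∀ j, σ (σ j) = j) ∧
      ∀ j, (SimpleGraph.fromRel fun a b : V => ∃ i, v i = true ∧ p i = a ∧ q i = b).Reachable
        (τ j) (τ (σ j))) →
    IsGRankGate ((Fintype.card V * (Fintype.card V + 1)) * k + k) ⟨n, f⟩ := by
  intro V _ _ n k p q τ f hf
  classical
  -- the coefficient field `F = Frac ℚ[γ]` and the skew generic source weights
  let R₀ := MvPolynomial (Fin k × Fin k) ℚ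
  let F := FractionRing R₀
  let c₀ : Fin k → Fin k → R₀ := fun i j =>
    if i < j then MvPolynomial.X (i, j) else if j < i then -MvPolynomial.X (j, i) else 0
  have hc₀ : ∀ i j, c₀ j i = -c₀ i j := fun i j => by
    simp only [c₀]
    rcases lt_trichotomy i j with h | h | h
    · rw [if_neg (lt_asymm h), if_pos h, if_pos h]
    · subst h
      simp
    · rw [if_pos h, if_neg (lt_asymm h), if_pos h, neg_neg]
  let cF : Fin k → Fin k → F := fun i j => algebraMap R₀ F (c₀ i j)
  -- the symbolic transfer matrix over `F[X]`, reindexed by `Fin d`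
  set L := Fintype.card V with hL
  let ι := ((V × Fin (L + 1)) × Fin k) ⊕ Fin k
  let N : Matrix ι ι (MvPolynomial (Fin n) F) :=
    bigN p q τ (fun i => MvPolynomial.X i) (fun i j => MvPolynomial.C (cF i j)) L
  have hcard : Fintype.card ι = (Fintype.card V * (Fintype.card V + 1)) * k + k := by
    simp only [ι, Fintype.card_sum, Fintype.card_prod, Fintype.card_fin, hL]
  let e : ι ≃ Fin (Fintype.card ι) := Fintype.equivFin ι
  let A : Matrix (Fin (Fintype.card ι)) (Fin (Fintype.card ι)) (MvPolynomial (Fin n) F) :=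
    Matrix.reindex e e N
  have hA1 : ∀ a b, (A a b).totalDegree ≤ 1 := fun a b =>
    totalDegree_bigN_le_one p q τ cF L (e.symm a) (e.symm b)
  -- killing the unselected variables in `det A` gives `± det schurM` at the killed weights
  have hkill : ∀ v, killVars v A.det = (-1) ^ k *
      (schurM p q τ (fun i => if v i then (MvPolynomial.X i : MvPolynomial (Fin n) F) else 0)
        (fun i j => MvPolynomial.C (cF i j)) L).det := by
    intro v
    have hdet : A.det = N.det := Matrix.det_reindex_self e N
    rw [hdet, AlgHom.map_det, AlgHom.mapMatrix_apply]
    have hN := bigN_map p q τ (fun i => (MvPolynomial.X i : MvPolynomial (Fin n) F))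
      (fun i j => MvPolynomial.C (cF i j)) L (killVars v).toRingHom
    simp only [AlgHom.toRingHom_eq_coe, AlgHom.coe_toRingHom] at hN
    have hX : (fun i => killVars v (MvPolynomial.X i : MvPolynomial (Fin n) F)) =
        fun i => if v i then (MvPolynomial.X i : MvPolynomial (Fin n) F) else 0 := by
      funext i
      exact killVars_X v i
    have hC : (fun i j => killVars v (MvPolynomial.C (cF i j) : MvPolynomial (Fin n) F)) =
        fun i j => MvPolynomial.C (cF i j) := by
      funext i j
      change killVars v (algebraMap F (MvPolynomial (Fin n) F) (cF i j)) = _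
      rw [AlgHom.commutes]
      rfl
    rw [hX, hC] at hN
    change (N.map (killVars v)).det = _
    rw [hN, det_bigN]
  -- the shadow: `killVars v (det A) ≠ 0 ↔` a good pairing exists
  have hshadow : ∀ v, killVars v A.det ≠ 0 ↔ ∃ σ : Equiv.Perm (Fin k), (∀ j, σ j ≠ j) ∧
      (∀ j, σ (σ j) = j) ∧ ∀ j, (SimpleGraph.fromRel fun a b : V => ∃ i, v i = true ∧ p i = a ∧ q i = b).Reachable
        (τ j) (τ (σ j)) := by
    intro v
    rw [hkill v]
    have hunit : ((-1 : MvPolynomial (Fin n) F) ^ k) ≠ 0 := pow_ne_zero _ (neg_ne_zero.2 one_ne_zero)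
    rw [mul_ne_zero_iff, and_iff_right hunit]
    constructor
    · -- soundness (contrapositive)
      intro hne
      by_contra hno
      refine hne (det_schurM_eq_zero_of_no_pairing p q τ v _ (fun i hi => by simp [hi]) _
        (fun i j => ?_) L hno)
      change MvPolynomial.C (algebraMap R₀ F (c₀ j i)) = -MvPolynomial.C (algebraMap R₀ F (c₀ i j))
      rw [hc₀ i j, map_neg, map_neg]
    · -- completeness: specialise through `ℚ[γ][X]`
      rintro ⟨σ, h1, h2, h3⟩
      -- the pairing matrix over `ℚ[γ][X]` and its image in `F[X]`
      let ψ : MvPolynomial (Fin n) R₀ →+* MvPolynomial (Fin n) F := MvPolynomial.map (algebraMap R₀ F)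
      have hψ : Function.Injective ψ := MvPolynomial.map_injective _ (IsFractionRing.injective R₀ F)
      let M₀ := schurM p q τ (fun i => if v i then (MvPolynomial.X i : MvPolynomial (Fin n) R₀) else 0)
        (fun i j => MvPolynomial.C (c₀ i j)) L
      have hmap : M₀.map ψ = schurM p q τ
          (fun i => if v i then (MvPolynomial.X i : MvPolynomial (Fin n) F) else 0)
          (fun i j => MvPolynomial.C (cF i j)) L := by
        rw [schurM_map]
        congr 1
        · funext i
          split_ifs
          · exact MvPolynomial.map_X _ _
          · exact map_zero ψ
        · funext i j
          exact MvPolynomial.map_C _ _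
      rw [← hmap, ← RingHom.mapMatrix_apply, ← RingHom.map_det, map_ne_zero_iff ψ hψ]
      -- evaluate `X_i ↦ [v_i]`, `γ ↦ [σ i = j]`
      let γσ : Fin k × Fin k → ℚ := fun ij => if σ ij.1 = ij.2 then 1 else 0
      let θ : MvPolynomial (Fin n) R₀ →+* ℚ :=
        MvPolynomial.eval₂Hom (MvPolynomial.eval γσ) fun i => if v i then 1 else 0
      intro h0
      have h0' : θ M₀.det = 0 := by rw [h0, map_zero]
      rw [RingHom.map_det, RingHom.mapMatrix_apply, schurM_map] at h0'
      have hw : (fun i => θ (if v i then (MvPolynomial.X i : MvPolynomial (Fin n) R₀) else 0)) =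
          fun i => if v i then (1 : ℚ) else 0 := by
        funext i
        by_cases hv : v i = true
        · rw [if_pos hv, if_pos hv]
          exact (MvPolynomial.eval₂Hom_X' _ _ i).trans (if_pos hv)
        · rw [if_neg hv, if_neg hv, map_zero]
      rw [hw] at h0'
      refine det_schurM_indicator_ne_zero p q τ v σ h2 h3 (fun i j => θ (MvPolynomial.C (c₀ i j)))
        (fun i j hij => ?_) (fun i => ?_) h0'
      · -- `c` vanishes off the pairing
        rw [MvPolynomial.eval₂Hom_C]
        simp only [c₀]
        split_ifs with hlt hgt
        · rw [MvPolynomial.eval_X]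
          exact if_neg hij
        · rw [map_neg, MvPolynomial.eval_X, neg_eq_zero]
          refine if_neg fun h => hij ?_
          have h' : σ j = i := h
          rw [← h', h2]
        · exact map_zero _
      · -- `c i (σ i) = ±1`
        rw [MvPolynomial.eval₂Hom_C]
        simp only [c₀]
        have hne : i ≠ σ i := (h1 i).symm
        split_ifs with hlt hgt
        · rw [MvPolynomial.eval_X]
          simp [γσ]
        · rw [map_neg, MvPolynomial.eval_X, neg_ne_zero]
          simp [γσ, h2]
        · exact absurd (lt_or_gt_of_ne hne) (not_or.2 ⟨hlt, hgt⟩)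
  -- assemble the GRANK gate (full rank of the generic symbolic matrix ↔ the killed determinant is non-zero)
  rw [← hcard]
  refine ⟨F, inferInstance, Fintype.card ι, Fintype.card ι, le_rfl, fun a b => coeff 0 (A a b),
    fun i => fun a b => coeff (Finsupp.single i 1) (A a b), fun v => ?_⟩
  change f v = true ↔ _
  rw [le_rank_iff_det_ne_zero_of_sq, Ne, ← Matrix.submatrix_id_id (symbolicMatrix _ _ v),
    det_submatrix_symbolicMatrix_eq_zero_iff, Matrix.submatrix_id_id, symbolicPolyMatrix_coeffs_eq A hA1,
    ← Ne, hshadow v, hf v]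

end

end Summit.PneNP.PneNP.Theorems.Capture.TJoin
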